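import Literature.AlgebraicGeometry.HodgeTheory.QuaternionicQuarticCoverGeneric
import Literature.AlgebraicGeometry.Motives.HypersurfaceChartAlgebra
import Literature.AlgebraicGeometry.Motives.ProjBasicOpenSubscheme
import Literature.AlgebraicGeometry.Motives.ReducedClosedSubschemeIso
import HarnessLib

/-!
# The fibres of the universal quaternionic quartic over the good open are INTEGRAL and are THE hypersurfaces `V₊(Q_φ)`

Layer `Literature/AlgebraicGeometry/HodgeTheory`. Theorems (plus plumbing abbreviations/definitions: the chart
element `baseChangeX`, the charts `chartA`/`chartL`, the chart equations `chartEqA`/`chartEqL`); no named fact.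
Written by the prover seat `hodge-nonav-19716-p2` (g13, cell `hodge-nonav`) as brick **QF-1b «COVER», clause (C3)**
of prover-Bx's programme Q-FAMILY (memo `PROGRAMME-Q-FAMILY-Bx-g18.md` §6–§7; route `HodgeConjecture/Q8SymplecticPowers`,
crux K1Q, stmt-HodgeConjecture-24190): the fibres `𝒱_φ = 𝒱 ×_A Spec L` of the REDUCED universal quaternionic
quartic `𝒱 = cover e` (`QuaternionicQuarticCover`) over field-valued points `φ : A → L` at which the specialised
form `Q_φ = φ(Q_e)` is irreducible — every point of the explicit open `D(G_e)`
(`QuaternionicQuarticPrimeSpecialisation.prime_map_univQ_of_genericity`) — are reduced, hence integral, hence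
isomorphic over `L` to every reduced hypersurface cut out by `Q_φ` (the predicate `IsHypersurfaceCutOutBy` of the
route's leaf and of `Q8Family.QFamily` (iii)).

Fibres of a reduced scheme are not automatically reduced; the proof computes the kernel ideal sheaf `𝓙` of the
closed immersion `fiberEmb e φ : 𝒱_φ ↪ ℙ³_L` on the standard charts:

* `prime_or_isUnit_isLocalizationElem` — for an irreducible form `F ∈ L[x₀,…,x_N]`, the chart equation
  `F/xᵢᵈ ∈ (L[x]_{xᵢ})₀` is prime or a unit (dehomogenisation through the chart isomorphism `L[y] ≅ (L[x]_{xᵢ})₀`,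
  `ProjectiveSpace.chartAlgEquiv`, and Hartshorne I Prop. 2.2 / Ex. 2.10 `irreducible_or_isUnit_dehomogenize`);
  `isRadical_span_singleton_of_prime_or_isUnit`.
* `baseChangeX e φ i = φ_*(xᵢ)` (`= xᵢ`, kept syntactically as the image under the graded base-change map so that
  Mathlib's `Proj.map_preimage_basicOpen` is `rfl`: `chartL_eq_preimage`), the charts `chartA`, `chartL` and the
  chart equations `chartEqA = Q_e/xᵢ^{2e+4}`, `chartEqL = Q_φ/xᵢ^{2e+4}` with `awayMap_chartEqA` (base change).
* **(a) `awayToSection_chartEqL_mem_ker`** — `q = Q_φ/xᵢ^{2e+4}` lies in `𝓙(D₊(xᵢ))`: it is the pull-back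
  (Mathlib `Proj.awayToSection_comp_appLE`) of the `A`-section `Q_e/xᵢ^{2e+4}`, which lies in the vanishing ideal
  sheaf of `V₊(Q_e)` (`ProjSubscheme.vanishingIdeal_ideal_affineBasicOpen`, `awayι_preimage_zeroLocus`) and so dies
  on `𝒱`; and `𝒱_φ → ℙ³_L → ℙ³_A` factors through `𝒱` (`fiberEmb_comp_projMapOfHom`).
* **(b) `ker_ideal_chartL_le`** — `𝓙 ≤` the vanishing ideal sheaf of the image `V₊(Q_φ)`, whose ideal over
  `D₊(xᵢ)` is `√(q) = (q)`; hence **`ker_ideal_chartL_eq`**: `𝓙(D₊(xᵢ)) = (q)`, radical (`isRadical_ker_ideal_chartL`).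
* **`isReduced_fiber`** — `V(𝓙)` is covered by the spectra of the reduced rings `Γ(D₊(xᵢ))/(q)`
  (`ProjSubscheme.subschemePiece`), and `𝒱_φ ≅ V(𝓙)` (`Scheme.Hom.toImage` of a closed immersion).
* Consequences: **`isIntegral_fiber`** (`Q_φ` prime), **`isIntegral_fiber_of_genericity`** (`φ(G_e) ≠ 0`),
  **`isHypersurfaceCutOutBy_fiberSch`**, **`nonempty_iso_of_isHypersurfaceCutOutBy`** (uniqueness of the reduced
  structure, `exists_iso_of_isClosedImmersion_of_range_eq`), and over `ℂ` literally for the route's form: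
  **`nonempty_iso_of_isHypersurfaceCutOutBy_quarticForm`**; `isIntegral_pullback_of_genericity` (points as morphisms
  `Spec L → Spec A`).

Honest scope: scheme bookkeeping for one explicit family of quartic surfaces; nothing here bears on HC.

## References

* [Hartshorne1977] R. Hartshorne, Algebraic Geometry (1977): I §2 (Prop. 2.2, Ex. 2.10), II Prop. 2.5 (b),
  II Example 3.2.6, II Prop. 5.9, II Ex. 3.11 (a).
* [Liu2002] Q. Liu, Algebraic Geometry and Arithmetic Curves (2002), Prop. 3.1.9 (`ℙⁿ_L = ℙⁿ_A ×_A L`, charts).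
* [GortzWedhorn2020] U. Görtz, T. Wedhorn, Algebraic Geometry I, 2nd ed. (2020), Prop. 3.27.
* [AtiyahMacdonald1969] M. Atiyah, I. Macdonald, Introduction to Commutative Algebra (1969), Ch. 1.
-/

noncomputable section

set_option backward.isDefEq.respectTransparency false

open CategoryTheory AlgebraicGeometry MvPolynomial Limits TopologicalSpace HomogeneousLocalization
open Literature.AlgebraicGeometry.Motives Literature.AlgebraicGeometry.Motives.UniversalHypersurface

universe u

namespace Literature.AlgebraicGeometry.HodgeTheory.Q8Family

attribute [local instance] MvPolynomial.gradedAlgebra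

/-! ### The dehomogenised equation `F/xᵢᵈ` of a prime form is prime or a unit in the chart ring -/

section ChartElement

variable {L : Type u} [Field L] {N : ℕ} (i : Fin (N + 1))

attribute [local instance] ProjBaseChange.algebraBase ProjBaseChange.isScalarTower_localization

/-- **`F/xᵢᵈ ∈ (L[x]_{xᵢ})₀` is prime or a unit for `F` an irreducible form** (it is the dehomogenisation
`F(xᵢ := 1)` read through the chart isomorphism `L[y] ≅ (L[x]_{xᵢ})₀`, Hartshorne I Thm. 3.4, and
dehomogenisation preserves irreducibility up to the unit case `F ∼ xᵢ`, Hartshorne I Prop. 2.2 / Ex. 2.10: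
`ProjectiveSpace.irreducible_or_isUnit_dehomogenize`). Stated for any `s = xᵢ` to absorb the proof term of
`s ∈ 𝒜₁`. [cite: Hartshorne1977, I §2, proof of Prop. 2.2 and Ex. 2.10] -/
theorem prime_or_isUnit_isLocalizationElem {s : MvPolynomial (Fin (N + 1)) L} (hs : s = X i)
    (s_deg : s ∈ homogeneousSubmodule (Fin (N + 1)) L 1) {d : ℕ} {F : MvPolynomial (Fin (N + 1)) L}
    (hF : F ∈ homogeneousSubmodule (Fin (N + 1)) L d) (hirr : Irreducible F) :
    Prime (Away.isLocalizationElem s_deg hF) ∨ IsUnit (Away.isLocalizationElem s_deg hF) := by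
  subst hs
  rw [ProjectiveSpace.isLocalizationElem_X i F hF]
  rcases ProjectiveSpace.irreducible_or_isUnit_dehomogenize i
      ((mem_homogeneousSubmodule d F).mp hF) hirr with hirr' | hu
  · left
    have hp : Prime (ProjectiveSpace.dehomogenize L i F) := hirr'.prime
    exact (MulEquiv.prime_iff (ProjectiveSpace.chartAlgEquiv L i).symm.toMulEquiv).mpr hp
  · exact Or.inr (hu.map _)

/-- In a commutative ring the span of a prime-or-unit element is a radical ideal. [cite: AtiyahMacdonald1969, Ch. 1 (p. 9, prime ideals are radical)] -/
theorem isRadical_span_singleton_of_prime_or_isUnit {R : Type u} [CommRing R] {q : R}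
    (hq : Prime q ∨ IsUnit q) : (Ideal.span {q}).IsRadical := by
  rcases hq with hp | hu
  · exact ((Ideal.span_singleton_prime hp.ne_zero).mpr hp).isRadical
  · rw [Ideal.span_singleton_eq_top.mpr hu]
    exact fun x _ => Submodule.mem_top

end ChartElement

/-! ### The fibre over a field point with `Q_φ` irreducible is reduced -/

section FibreReduced

variable (e : ℕ) {L : Type} [Field L] (φ : ParamRing e →+* L)

/-- The chart element `φ_*(xᵢ) ∈ L[x₀,…,x₃]` (the image of `xᵢ` under the graded base-change map
`A[x] → L[x]`; equal to `xᵢ`, `baseChangeX_eq`, but kept in this syntactic form so that Mathlib's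
`Proj.map_preimage_basicOpen` and `Proj.awayToSection_comp_appLE` apply on the nose). [cite: Liu2002, Prop. 3.1.9] -/
def baseChangeX (i : Fin (2 + 2)) : MvPolynomial (Fin (2 + 2)) L :=
  letI : Algebra (ParamRing e) L := φ.toAlgebra
  ProjBaseChangeRing.mapGraded (ParamRing e) L (Fin (2 + 2)) (X i)

/-- `φ_*(xᵢ) = xᵢ`. [cite: Liu2002, Prop. 3.1.9] -/
theorem baseChangeX_eq (i : Fin (2 + 2)) : baseChangeX e φ i = X i := by
  letI : Algebra (ParamRing e) L := φ.toAlgebra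
  change MvPolynomial.map (algebraMap (ParamRing e) L) (X i) = X i
  exact map_X _ i

/-- `φ_*(xᵢ)` has degree `1`. [cite: Liu2002, Prop. 3.1.9] -/
theorem baseChangeX_mem (i : Fin (2 + 2)) : baseChangeX e φ i ∈ homogeneousSubmodule (Fin (2 + 2)) L 1 := by
  rw [baseChangeX_eq]; exact isHomogeneous_X L i

/-- The affine chart `D₊(xᵢ) ⊆ ℙ³_A`. [cite: Hartshorne1977, II Prop. 2.5 (b)] -/
abbrev chartA (i : Fin (2 + 2)) : (projSp 2 (ParamRing e)).affineOpens :=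
  ProjSubscheme.affineBasicOpen (homogeneousSubmodule (Fin (2 + 2)) (ParamRing e)) (X i)
    (isHomogeneous_X _ i) one_pos

/-- The affine chart `D₊(φ_* xᵢ) = (ℙ³_L → ℙ³_A)⁻¹ D₊(xᵢ) ⊆ ℙ³_L`. [cite: Hartshorne1977, II Prop. 2.5 (b)] -/
abbrev chartL (i : Fin (2 + 2)) : (projSp 2 L).affineOpens :=
  ProjSubscheme.affineBasicOpen (homogeneousSubmodule (Fin (2 + 2)) L) (baseChangeX e φ i)
    (baseChangeX_mem e φ i) one_pos

/-- `D₊(φ_* xᵢ)` IS the preimage of `D₊(xᵢ)` (Mathlib `Proj.map_preimage_basicOpen`, `rfl`). [cite: Liu2002, Prop. 3.1.9] -/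
theorem chartL_eq_preimage (i : Fin (2 + 2)) :
    (chartL e φ i : (projSp 2 L).Opens) = projMapOfHom e φ ⁻¹ᵁ (chartA e i : (projSp 2 (ParamRing e)).Opens) :=
  rfl

/-- The universal form lies in the degree-`(2e+4)` piece. [cite: Hartshorne1977, I §2 (p. 9, the grading of S = k[x₀,…,xₙ])] -/
theorem univQ_mem (he : 1 ≤ e) : univQ e ∈ homogeneousSubmodule (Fin (2 + 2)) (ParamRing e) (2 * e + 4) :=
  (mem_homogeneousSubmodule _ _).mpr (isHomogeneous_univQ e he)

/-- The specialised form lies in the degree-`(2e+4)` piece. [cite: Hartshorne1977, I §2 (p. 9, the grading of S = k[x₀,…,xₙ])] -/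
theorem map_univQ_mem (he : 1 ≤ e) :
    MvPolynomial.map φ (univQ e) ∈ homogeneousSubmodule (Fin (2 + 2)) L (2 * e + 4) :=
  (mem_homogeneousSubmodule _ _).mpr ((isHomogeneous_univQ e he).map φ)

/-- The chart equation `t₀ = Q_e/xᵢ^{2e+4} ∈ (A[x]_{xᵢ})₀`. [cite: Hartshorne1977, II Prop. 2.5 (b)] -/
abbrev chartEqA (he : 1 ≤ e) (i : Fin (2 + 2)) : Away (homogeneousSubmodule (Fin (2 + 2)) (ParamRing e)) (X i) :=
  Away.isLocalizationElem (isHomogeneous_X _ i) (univQ_mem e he)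

/-- The chart equation `q = Q_φ/xᵢ^{2e+4} ∈ (L[x]_{φ_* xᵢ})₀` of the fibre. [cite: Hartshorne1977, II Prop. 2.5 (b)] -/
abbrev chartEqL (he : 1 ≤ e) (i : Fin (2 + 2)) : Away (homogeneousSubmodule (Fin (2 + 2)) L) (baseChangeX e φ i) :=
  Away.isLocalizationElem (baseChangeX_mem e φ i) (map_univQ_mem e φ he)

/-- **The chart equation of the fibre is the base change of the universal chart equation**
(Mathlib `HomogeneousLocalization.Away.map`). [cite: Liu2002, Prop. 3.1.9] -/
theorem awayMap_chartEqA (he : 1 ≤ e) (i : Fin (2 + 2)) :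
    letI : Algebra (ParamRing e) L := φ.toAlgebra
    Away.map (ProjBaseChangeRing.mapGraded (ParamRing e) L (Fin (2 + 2))) (X i) (chartEqA e he i) =
      chartEqL e φ he i := by
  letI : Algebra (ParamRing e) L := φ.toAlgebra
  refine HomogeneousLocalization.val_injective _ ?_
  simp only [Away.map_mk, Away.val_mk, map_pow]
  rfl

/-- **(a) The chart equation vanishes on the fibre**: the section `q ∈ Γ(ℙ³_L, D₊(φ_* xᵢ))` lies in the
kernel ideal sheaf of `𝒱_φ ↪ ℙ³_L` — it is the pull-back (`Proj.awayToSection_comp_appLE`) of the section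
`Q_e/xᵢ^{2e+4} ∈ Γ(ℙ³_A, D₊(xᵢ))`, which lies in the vanishing ideal sheaf of `V₊(Q_e)` and hence dies on `𝒱`.
[cite: Hartshorne1977, II Example 3.2.6] -/
theorem awayToSection_chartEqL_mem_ker (he : 1 ≤ e) (i : Fin (2 + 2)) :
    Proj.awayToSection _ (baseChangeX e φ i) (chartEqL e φ he i) ∈ (fiberEmb e φ).ker.ideal (chartL e φ i) := by
  letI : Algebra (ParamRing e) L := φ.toAlgebra
  -- the `A`-side section `σA = Q_e/xᵢ^{2e+4}` lies in the ideal of `𝒱` over `D₊(xᵢ)`, hence dies on `𝒱`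
  have hσA_mem : Proj.awayToSection (homogeneousSubmodule (Fin (2 + 2)) (ParamRing e)) (X i) (chartEqA e he i) ∈
      (idealSheaf e).ideal (chartA e i) := by
    rw [idealSheaf, ProjSubscheme.vanishingIdeal_ideal_affineBasicOpen, coe_zeroLocusClosed]
    refine Ideal.mem_map_of_mem _ ?_
    have key := ProjSubscheme.awayι_preimage_zeroLocus (homogeneousSubmodule (Fin (2 + 2)) (ParamRing e))
      (isHomogeneous_X (ParamRing e) i) one_pos (univQ_mem e he) (by omega)
    refine (le_of_eq (congrArg PrimeSpectrum.vanishingIdeal key).symm) ?_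
    exact PrimeSpectrum.subset_vanishingIdeal_zeroLocus _ (Set.mem_singleton _)
  have hzero : (coverEmb e).app (chartA e i)
      (Proj.awayToSection (homogeneousSubmodule (Fin (2 + 2)) (ParamRing e)) (X i) (chartEqA e he i)) = 0 :=
    Morphisms.subschemeι_app_eq_zero (idealSheaf e) hσA_mem
  -- the `L`-side section is the pull-back of `σA` along `ℙ³_L → ℙ³_A`
  have hcomp := Proj.awayToSection_comp_appLE (ProjBaseChangeRing.mapGraded (ParamRing e) L (Fin (2 + 2)))
    (ProjBaseChangeRing.irrelevant_le_map (ParamRing e) L (Fin (2 + 2))) (isHomogeneous_X (ParamRing e) i)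
  have hσL : Proj.awayToSection _ (baseChangeX e φ i) (chartEqL e φ he i) =
      (projMapOfHom e φ).app (chartA e i)
        (Proj.awayToSection (homogeneousSubmodule (Fin (2 + 2)) (ParamRing e)) (X i) (chartEqA e he i)) := by
    rw [← awayMap_chartEqA e φ he i, Scheme.Hom.app_eq_appLE]
    have := congrArg (fun k => k.hom (chartEqA e he i)) hcomp
    simp only [CommRingCat.hom_comp, RingHom.coe_comp, Function.comp_apply, CommRingCat.hom_ofHom] at this
    exact this.symm
  -- kernel membership: `f^*(g^* σA) = (f ≫ g)^* σA = (fst ≫ coverEmb)^* σA = fst^* 0 = 0`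
  rw [Scheme.Hom.ker_apply, RingHom.mem_ker, hσL]
  change ((projMapOfHom e φ).app (chartA e i) ≫ (fiberEmb e φ).app (projMapOfHom e φ ⁻¹ᵁ (chartA e i))) _ = 0
  rw [← Scheme.Hom.comp_app, Scheme.Hom.congr_app (fiberEmb_comp_projMapOfHom e φ) (chartA e i),
    Scheme.Hom.comp_app]
  simp only [CategoryTheory.comp_apply, hzero, map_zero]

/-- **(b) The kernel on the chart is at most `(q)`**: the kernel ideal sheaf of `𝒱_φ ↪ ℙ³_L` is contained in the
vanishing ideal sheaf of its image `V₊(Q_φ)`, whose ideal over `D₊(φ_* xᵢ)` is the radical of `(q)`, i.e. `(q)`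
(`q` prime or a unit for `Q_φ` irreducible). [cite: Hartshorne1977, II Example 3.2.6] -/
theorem ker_ideal_chartL_le (he : 1 ≤ e) (hirr : Irreducible (MvPolynomial.map φ (univQ e))) (i : Fin (2 + 2)) :
    (fiberEmb e φ).ker.ideal (chartL e φ i) ≤
      Ideal.span {Proj.awayToSection _ (baseChangeX e φ i) (chartEqL e φ he i)} := by
  let Z : Closeds (projSp 2 L) := ⟨Set.range (fiberEmb e φ), (fiberEmb e φ).isClosedEmbedding.isClosed_range⟩
  have hle : (fiberEmb e φ).ker ≤ Scheme.IdealSheafData.vanishingIdeal Z := by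
    refine Scheme.IdealSheafData.le_support_iff_le_vanishingIdeal.mp ?_
    intro x hx
    rw [← SetLike.mem_coe, Scheme.Hom.support_ker]
    exact subset_closure hx
  refine (hle (chartL e φ i)).trans (le_of_eq ?_)
  -- `awayι⁻¹(V₊(Q_φ)) = V(q)` and `I(V(q)) = √(q) = (q)`
  have key := ProjSubscheme.awayι_preimage_zeroLocus (homogeneousSubmodule (Fin (2 + 2)) L)
    (baseChangeX_mem e φ i) one_pos (map_univQ_mem e φ he) (by omega)
  have hZ : ((Z : Set (projSp 2 L))) =
      ProjectiveSpectrum.zeroLocus (homogeneousSubmodule (Fin (2 + 2)) L) {MvPolynomial.map φ (univQ e)} :=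
    range_fiberEmb e φ
  have inner : PrimeSpectrum.vanishingIdeal
      ((Proj.awayι (homogeneousSubmodule (Fin (2 + 2)) L) (baseChangeX e φ i) (baseChangeX_mem e φ i) one_pos)
        ⁻¹' (Z : Set (projSp 2 L))) = Ideal.span {chartEqL e φ he i} := by
    refine ((congrArg PrimeSpectrum.vanishingIdeal (congrArg _ hZ)).trans
      ((congrArg PrimeSpectrum.vanishingIdeal key).trans ?_))
    rw [← PrimeSpectrum.zeroLocus_span, PrimeSpectrum.vanishingIdeal_zeroLocus_eq_radical]
    exact (isRadical_span_singleton_of_prime_or_isUnit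
      (prime_or_isUnit_isLocalizationElem i (baseChangeX_eq e φ i) (baseChangeX_mem e φ i)
        (map_univQ_mem e φ he) hirr)).radical
  rw [ProjSubscheme.vanishingIdeal_ideal_affineBasicOpen]
  refine (congrArg (Ideal.map _) inner).trans ?_
  rw [Ideal.map_span, Set.image_singleton]

/-- **The kernel ideal on the chart `D₊(φ_* xᵢ)` is `(q)`, `q = Q_φ/xᵢ^{2e+4}`.** [cite: Hartshorne1977, II Prop. 5.9 and Example 3.2.6] -/
theorem ker_ideal_chartL_eq (he : 1 ≤ e) (hirr : Irreducible (MvPolynomial.map φ (univQ e))) (i : Fin (2 + 2)) :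
    (fiberEmb e φ).ker.ideal (chartL e φ i) =
      Ideal.span {Proj.awayToSection _ (baseChangeX e φ i) (chartEqL e φ he i)} :=
  le_antisymm (ker_ideal_chartL_le e φ he hirr i)
    ((Ideal.span_singleton_le_iff_mem _).mpr (awayToSection_chartEqL_mem_ker e φ he i))

/-- The kernel ideal on each chart is radical (`q` is prime or a unit, and `(L[x]_{xᵢ})₀ ≅ Γ(D₊(xᵢ))`).
[cite: Hartshorne1977, II Prop. 2.5 (b)] -/
theorem isRadical_ker_ideal_chartL (he : 1 ≤ e) (hirr : Irreducible (MvPolynomial.map φ (univQ e))) (i : Fin (2 + 2)) :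
    ((fiberEmb e φ).ker.ideal (chartL e φ i)).IsRadical := by
  rw [ker_ideal_chartL_eq e φ he hirr i]
  refine isRadical_span_singleton_of_prime_or_isUnit ?_
  have hq := prime_or_isUnit_isLocalizationElem i (baseChangeX_eq e φ i) (baseChangeX_mem e φ i)
    (map_univQ_mem e φ he) hirr
  let eiso := (Proj.basicOpenIsoAway (homogeneousSubmodule (Fin (2 + 2)) L) (baseChangeX e φ i)
    (baseChangeX_mem e φ i) one_pos).commRingCatIsoToRingEquiv
  have heq : ∀ x, (Proj.awayToSection _ (baseChangeX e φ i)).hom x = eiso x := fun x => rfl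
  rcases hq with hp | hu
  · left
    rw [heq]
    exact (MulEquiv.prime_iff eiso.toMulEquiv).mpr hp
  · exact Or.inr (hu.map _)

/-- **The fibre `𝒱_φ = 𝒱 ×_A Spec L` is REDUCED** when the specialised form `Q_φ` is irreducible (`e ≥ 1`):
it is the closed subscheme of `ℙ³_L` of the kernel ideal sheaf of `fiberEmb`, covered by the spectra of the
reduced rings `Γ(D₊(xᵢ))/(q)`. [cite: Hartshorne1977, II Prop. 5.9 and Example 3.2.6] -/
theorem isReduced_fiber (he : 1 ≤ e) (hirr : Irreducible (MvPolynomial.map φ (univQ e))) :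
    IsReduced ↑(pullback (cover e).hom (Spec.map (CommRingCat.ofHom φ))) := by
  set f := fiberEmb e φ with hf
  let J := f.ker
  -- the pieces over the four charts are reduced
  haveI hpiece : ∀ i : Fin (2 + 2), IsReduced (Spec (CommRingCat.of
      (Γ(projSp 2 L, (chartL e φ i : (projSp 2 L).Opens)) ⧸ J.ideal (chartL e φ i)))) := fun i => by
    haveI : _root_.IsReduced (Γ(projSp 2 L, (chartL e φ i : (projSp 2 L).Opens)) ⧸ J.ideal (chartL e φ i)) :=
      (Ideal.isRadical_iff_quotient_reduced _).mp (isRadical_ker_ideal_chartL e φ he hirr i)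
    infer_instance
  -- they cover `V(J)`
  let 𝒰 : J.subscheme.OpenCover :=
    Scheme.Cover.mkOfCovers (Fin (2 + 2))
      (fun i => Spec (CommRingCat.of (Γ(projSp 2 L, (chartL e φ i : (projSp 2 L).Opens)) ⧸ J.ideal (chartL e φ i))))
      (fun i => ProjSubscheme.subschemePiece J (chartL e φ i)) (fun y => by
        -- the point of `ℙ³_L` under `y` lies in some `D₊(xᵢ) = D₊(φ_* xᵢ)`
        set p := J.subschemeι y with hp
        have hXall : ¬ ∀ i, (X i : MvPolynomial (Fin (2 + 2)) L) ∈ p.asHomogeneousIdeal := by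
          intro h
          refine p.not_irrelevant_le fun a ha => ?_
          exact Ideal.span_le.mpr (Set.range_subset_iff.mpr h)
            (ProjBaseChangeRing.irrelevant_le_span_X L ha)
        obtain ⟨i, hi⟩ : ∃ i, (X i : MvPolynomial (Fin (2 + 2)) L) ∉ p.asHomogeneousIdeal := by
          by_contra! h; exact hXall h
        have hmem : p ∈ (chartL e φ i : (projSp 2 L).Opens) := by
          change p ∈ Proj.basicOpen _ (baseChangeX e φ i)
          rw [baseChangeX_eq]
          exact hi
        have hy : y ∈ (ProjSubscheme.subschemePiece J (chartL e φ i)).opensRange := by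
          rw [ProjSubscheme.opensRange_subschemePiece]
          exact hmem
        obtain ⟨z, hz⟩ := hy
        exact ⟨i, z, hz⟩)
  haveI : ∀ i, IsReduced (𝒰.X i) := hpiece
  haveI : IsReduced J.subscheme := IsReduced.of_openCover (𝒰 := 𝒰)
  -- `𝒱_φ ≅ V(J)` (scheme-theoretic image of a closed immersion)
  exact isReduced_of_isOpenImmersion f.toImage

end FibreReduced

/-! ### Consequences: integral fibres; the fibre IS the hypersurface `V₊(Q_φ)` -/

section Consequences

variable (e : ℕ) {L : Type} [Field L] (φ : ParamRing e →+* L)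

/-- **The fibre `𝒱_φ` is INTEGRAL when `Q_φ` is prime** (`e ≥ 1`): reduced (`isReduced_fiber`) and irreducible
(`irreducibleSpace_fiber`). [cite: GortzWedhorn2020, Prop. 3.27] -/
theorem isIntegral_fiber (he : 1 ≤ e) (hprime : Prime (MvPolynomial.map φ (univQ e))) :
    IsIntegral (fiberSch e φ).left := by
  haveI : IsReduced (fiberSch e φ).left := isReduced_fiber e φ he hprime.irreducible
  haveI : IrreducibleSpace ↑(fiberSch e φ).left := irreducibleSpace_fiber e φ he hprime
  exact isIntegral_of_irreducibleSpace_of_isReduced _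

/-- **The fibres over the good open `D(G_e)` are integral** (any field-valued point `φ` with `φ(G_e) ≠ 0`,
e.g. every complex point of `D(G_e)`; `e ≥ 1`). [cite: GortzWedhorn2020, Prop. 3.27] -/
theorem isIntegral_fiber_of_genericity (he : 1 ≤ e) (hG : φ (genericityElem e) ≠ 0) :
    IsIntegral (fiberSch e φ).left :=
  isIntegral_fiber e φ he (prime_map_univQ_of_genericity φ hG)

/-- **The fibre `𝒱_φ` is the reduced hypersurface of `ℙ³_L` cut out by `Q_φ`** (`IsHypersurfaceCutOutBy`, the
predicate of the route's leaf) when `Q_φ` is prime. [cite: Hartshorne1977, II Example 3.2.6] -/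
theorem isHypersurfaceCutOutBy_fiberSch (he : 1 ≤ e) (hprime : Prime (MvPolynomial.map φ (univQ e))) :
    IsHypersurfaceCutOutBy 3 (MvPolynomial.map φ (univQ e)) (fiberSch e φ) :=
  ⟨show IsReduced (fiberSch e φ).left from isReduced_fiber e φ he hprime.irreducible, fiberSchEmb e φ,
    inferInstance, range_fiberSchEmb e φ⟩

/-- **Uniqueness: every reduced hypersurface `V ⊂ ℙ³_L` cut out by `Q_φ` is isomorphic to the fibre `𝒱_φ`
over `L`** (`Q_φ` prime; both are reduced closed subschemes of `ℙ³_L` with support `V₊(Q_φ)`, Hartshorne II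
Example 3.2.6 — the tree's `exists_iso_of_isClosedImmersion_of_range_eq`). [cite: Hartshorne1977, II Example 3.2.6] -/
theorem nonempty_iso_of_isHypersurfaceCutOutBy (he : 1 ≤ e) (hprime : Prime (MvPolynomial.map φ (univQ e)))
    {V : SchemeOver L} (hV : IsHypersurfaceCutOutBy 3 (MvPolynomial.map φ (univQ e)) V) :
    Nonempty (fiberSch e φ ≅ V) := by
  obtain ⟨hVred, ι, hι, hrange⟩ := hV
  haveI := hVred
  haveI := isReduced_fiber e φ he hprime.irreducible
  let ι' : V.left ⟶ projSp 2 L := ι.left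
  haveI : IsClosedImmersion ι' := hι
  obtain ⟨eV, heV⟩ := exists_iso_of_isClosedImmersion_of_range_eq ι' (fiberEmb e φ)
    (hrange.trans (range_fiberEmb e φ).symm)
  refine ⟨Over.isoMk eV ?_⟩
  have hw : ι' ≫ projSpToSpec 2 L = V.hom := Over.w ι
  change eV.hom ≫ V.hom = pullback.snd (cover e).hom (Spec.map (CommRingCat.ofHom φ))
  rw [← hw, ← Category.assoc, heV, fiberEmb_comp_projSpToSpec]

/-- **Over a complex point `φ` of the good open `D(G_e)`, every hypersurface cut out by the route's
`quarticForm e (cOf a) (ψOf a)`, `a = (φ (X i))_i`, is isomorphic over `ℂ` to the fibre `𝒱_φ`** (`e ≥ 1`) —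
clause (C3) of brick QF-1 in the currency of `Q8Family.QFamily` (iii). [cite: Hartshorne1977, II Example 3.2.6] -/
theorem nonempty_iso_of_isHypersurfaceCutOutBy_quarticForm (φ : ParamRing e →+* ℂ) (he : 1 ≤ e)
    (hG : φ (genericityElem e) ≠ 0) {V : SchemeOver ℂ}
    (hV : IsHypersurfaceCutOutBy 3 (quarticForm e (cOf fun i => φ (X i)) (ψOf fun i => φ (X i))) V) :
    Nonempty (fiberSch e φ ≅ V) := by
  rw [← map_univQ_eq_quarticForm] at hV
  exact nonempty_iso_of_isHypersurfaceCutOutBy e φ he (prime_map_univQ_of_genericity φ hG) hV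

/-- The same for complex points given as morphisms `t : Spec ℂ → Spec A` landing in `D(G_e)`: with
`φ = Spec.preimage t`, `Spec.map (CommRingCat.ofHom φ) = t`. [cite: Hartshorne1977, II Example 3.2.6] -/
theorem isIntegral_pullback_of_genericity (he : 1 ≤ e) (t : Spec (.of L) ⟶ Spec (.of (ParamRing e)))
    (hG : (Spec.preimage t).hom (genericityElem e) ≠ 0) :
    IsIntegral ↑(pullback (cover e).hom t) := by
  have ht : Spec.map (CommRingCat.ofHom (Spec.preimage t).hom) = t := by
    rw [CommRingCat.ofHom_hom, Spec.map_preimage]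
  have h := isIntegral_fiber_of_genericity e (Spec.preimage t).hom he hG
  rwa [show (fiberSch e (Spec.preimage t).hom).left = pullback (cover e).hom t by
    change pullback (cover e).hom (Spec.map (CommRingCat.ofHom (Spec.preimage t).hom)) = _; rw [ht]] at h

end Consequences

end Literature.AlgebraicGeometry.HodgeTheory.Q8Family

end
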